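import Summits.BirchSwinnertonDyer.BirchSwinnertonDyer.Theorems.ManinLocalTwoThreePinningKernelFricke
import Summits.BirchSwinnertonDyer.BirchSwinnertonDyer.Theorems.ManinLocalTwoThreePinningKernelStaged
import Summits.BirchSwinnertonDyer.BirchSwinnertonDyer.Theorems.ManinLocalTwoThreePinningOneThirtySixTablesB
import Literature.NumberTheory.EllipticCurves.ModularFormsGamma0WeightTwoDimension
import HarnessLib

/-!
# Level 136 (genus 15) by the PINNING KERNEL: THE NEWFORM OF EVERY `X₀(136)`-DATUM IS `F_{136a/136b}`, FACT-FREE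

Cell `bsd-f2-manin`, route `ManinLocalTwoThree`, crux C2 `ManinOddAtFour` (stmt-BirchSwinnertonDyer-22967), an g55 (LENS
analytic/periods); `--supports stmt-BirchSwinnertonDyer-22967` (helper).  INSTANCE of `…PinningKernel{Sieve,,Fricke}`: the level-63
template with the script-emitted data of level 136 (`an/g55/scripts/pk_data55.py 136 64`, `emit_level55.py 136 M`, `emit_levelfile55.py`) and the
index data of `Γ₀(136)`; kernel certificates only, no level-specific algebra; the data and the table certificates are parts 1–2 (`…PinningOneThirtySixTables`, `…PinningOneThirtySixTablesB`), this file is part 3 (duals, staged sieve, Fricke sieve, dimension, pinning).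

THE RESULT.  `M₂(Γ₀(136))` (dimension `22 = g + ν_∞ − 1 = 15 + 8 − 1`) is spanned by 22 holomorphic `η`-quotients `C₀,…`
(`Ls`, closed under the Fricke reflection `σ`), certified tables to depth `64`, integer duals (`d = 8704`).  The staged box sieve over
the primes `2, 3, 5, 7, 11, 13, 17, 19, 23, 29, 31` with the certified column relations leaves 4 prime assignment(s) (`certs`); the Fricke
sieve keeps `goodCerts` (Cremona `136a/136b`; the others are old classes, killed for both signs by `decide`):
**`pinning (D)`**: for some `(σ, d′, y) ∈ goodCerts`, `truth W = σ ∧ d′ • D.f = Σ_j y_j • C_j`, in `M₂(Γ₀(136))`, for every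
`X₀(136)`-datum `D` of any elliptic `W/ℚ`.  HONEST FRAMING: unconditional, standard axioms; no newness/eigen statement about the
combination is proved; the Néron/`c`-side at `136` is NOT touched; nothing here proves C2/C3, Manin's conjecture or BSD.
[cite: CremonaAlgorithms1997, §2.10, Table 1 (136a/136b)] [cite: AtkinLehner1970, Thm. 3] [cite: Koehler2011, §2.1, §2.4]
[cite: Ligozat1975, Ch. 3] [cite: DiamondShurman2005, Thm. 3.5.1]
-/

set_option autoImplicit false
-- lint-debt: the directory name repeats the summit name (sibling precedent `ManinLocalTwoThreePinningSixtyThree.lean`)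
set_option linter.dupNamespace false

noncomputable section


open Complex
open UpperHalfPlane hiding I
open scoped MatrixGroups ModularForm
open ModularForm CongruenceSubgroup
open Literature.NumberTheory.ModularForms
open Literature.NumberTheory.EllipticCurves Literature.NumberTheory.EllipticCurves.ModularForms

namespace Summit.BirchSwinnertonDyer.BirchSwinnertonDyer.Theorems.ManinLocalTwoThree.PinningOneThirtySix

open Summit.BirchSwinnertonDyer.BirchSwinnertonDyer.Theorems.ManinLocalTwoThree.BracketSturm
open Summit.BirchSwinnertonDyer.BirchSwinnertonDyer.Theorems.ManinLocalTwoThree.PinningKernel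


set_option maxHeartbeats 4000000
set_option maxRecDepth 16384

/-! ## §2c Duals, the staged sieve, the Fricke data -/

/-- **The dual certificate** `⟨dualsᵢ, tabsⱼ⟩ = 8704·δᵢⱼ`. [folklore] -/
theorem hdual : ∀ i j : Fin 22, dotList (duals i) (tabs j) = if i = j then (8704 : ℤ) else 0 := by
  decide +kernel

/-- The dual vectors live below depth `64`. [folklore] -/
theorem hlen : ∀ i : Fin 22, (duals i).length ≤ 64 := by
  decide +kernel

/-- **The relation certificate**: every stage relation is a column relation of the tables. [folklore] -/
theorem hrel : ∀ st ∈ stages, ∀ v ∈ st.2, v.length ≤ 64 ∧ ∀ j : Fin 22, dotList v (tabs j) = 0 := by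
  decide +kernel

/-- Sieve stage `0`: the live list `L_0` is mapped into `L_1` (kernel `decide`). [folklore] -/
theorem hst0 : ∀ σ ∈ sieveStep 136 64 ((([[]] : List (List (ℕ × ℤ))) :: lvs).getD 0 []) (stages.getD 0 (0, [])), σ ∈ lvs.getD 0 [] := by decide +kernel
/-- Sieve stage `1`: the live list `L_1` is mapped into `L_2` (kernel `decide`). [folklore] -/
theorem hst1 : ∀ σ ∈ sieveStep 136 64 ((([[]] : List (List (ℕ × ℤ))) :: lvs).getD 1 []) (stages.getD 1 (0, [])), σ ∈ lvs.getD 1 [] := by decide +kernel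
/-- Sieve stage `2`: the live list `L_2` is mapped into `L_3` (kernel `decide`). [folklore] -/
theorem hst2 : ∀ σ ∈ sieveStep 136 64 ((([[]] : List (List (ℕ × ℤ))) :: lvs).getD 2 []) (stages.getD 2 (0, [])), σ ∈ lvs.getD 2 [] := by decide +kernel
/-- Stage 3 (`p = 7`, 63 live × box 11) is certified in 6 chunks. [folklore] -/
def chunks3 : List (List (List (ℕ × ℤ))) :=
  [[[(2, 0), (3, -3), (5, -4)], [(2, 0), (3, -3), (5, -3)], [(2, 0), (3, -3), (5, -2)], [(2, 0), (3, -3), (5, -1)], [(2, 0), (3, -3), (5, 0)], [(2, 0), (3, -3), (5, 1)], [(2, 0), (3, -3), (5, 2)], [(2, 0), (3, -3), (5, 3)], [(2, 0), (3, -3), (5, 4)], [(2, 0), (3, -2), (5, -4)], [(2, 0), (3, -2), (5, -3)]],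
   [[(2, 0), (3, -2), (5, -2)], [(2, 0), (3, -2), (5, -1)], [(2, 0), (3, -2), (5, 0)], [(2, 0), (3, -2), (5, 1)], [(2, 0), (3, -2), (5, 2)], [(2, 0), (3, -2), (5, 3)], [(2, 0), (3, -2), (5, 4)], [(2, 0), (3, -1), (5, -4)], [(2, 0), (3, -1), (5, -3)], [(2, 0), (3, -1), (5, -2)], [(2, 0), (3, -1), (5, -1)]],
   [[(2, 0), (3, -1), (5, 0)], [(2, 0), (3, -1), (5, 1)], [(2, 0), (3, -1), (5, 2)], [(2, 0), (3, -1), (5, 3)], [(2, 0), (3, -1), (5, 4)], [(2, 0), (3, 0), (5, -4)], [(2, 0), (3, 0), (5, -3)], [(2, 0), (3, 0), (5, -2)], [(2, 0), (3, 0), (5, -1)], [(2, 0), (3, 0), (5, 0)], [(2, 0), (3, 0), (5, 1)]],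
   [[(2, 0), (3, 0), (5, 2)], [(2, 0), (3, 0), (5, 3)], [(2, 0), (3, 0), (5, 4)], [(2, 0), (3, 1), (5, -4)], [(2, 0), (3, 1), (5, -3)], [(2, 0), (3, 1), (5, -2)], [(2, 0), (3, 1), (5, -1)], [(2, 0), (3, 1), (5, 0)], [(2, 0), (3, 1), (5, 1)], [(2, 0), (3, 1), (5, 2)], [(2, 0), (3, 1), (5, 3)]],
   [[(2, 0), (3, 1), (5, 4)], [(2, 0), (3, 2), (5, -4)], [(2, 0), (3, 2), (5, -3)], [(2, 0), (3, 2), (5, -2)], [(2, 0), (3, 2), (5, -1)], [(2, 0), (3, 2), (5, 0)], [(2, 0), (3, 2), (5, 1)], [(2, 0), (3, 2), (5, 2)], [(2, 0), (3, 2), (5, 3)], [(2, 0), (3, 2), (5, 4)], [(2, 0), (3, 3), (5, -4)]],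
   [[(2, 0), (3, 3), (5, -3)], [(2, 0), (3, 3), (5, -2)], [(2, 0), (3, 3), (5, -1)], [(2, 0), (3, 3), (5, 0)], [(2, 0), (3, 3), (5, 1)], [(2, 0), (3, 3), (5, 2)], [(2, 0), (3, 3), (5, 3)], [(2, 0), (3, 3), (5, 4)]]]
/-- Sieve stage `3`, chunk `0` (kernel `decide`). [folklore] -/
theorem hst3c0 : ∀ σ ∈ sieveStep 136 64 (chunks3.getD 0 []) (stages.getD 3 (0, [])), σ ∈ lvs.getD 3 [] := by decide +kernel
/-- Sieve stage `3`, chunk `1` (kernel `decide`). [folklore] -/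
theorem hst3c1 : ∀ σ ∈ sieveStep 136 64 (chunks3.getD 1 []) (stages.getD 3 (0, [])), σ ∈ lvs.getD 3 [] := by decide +kernel
/-- Sieve stage `3`, chunk `2` (kernel `decide`). [folklore] -/
theorem hst3c2 : ∀ σ ∈ sieveStep 136 64 (chunks3.getD 2 []) (stages.getD 3 (0, [])), σ ∈ lvs.getD 3 [] := by decide +kernel
/-- Sieve stage `3`, chunk `3` (kernel `decide`). [folklore] -/
theorem hst3c3 : ∀ σ ∈ sieveStep 136 64 (chunks3.getD 3 []) (stages.getD 3 (0, [])), σ ∈ lvs.getD 3 [] := by decide +kernel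
/-- Sieve stage `3`, chunk `4` (kernel `decide`). [folklore] -/
theorem hst3c4 : ∀ σ ∈ sieveStep 136 64 (chunks3.getD 4 []) (stages.getD 3 (0, [])), σ ∈ lvs.getD 3 [] := by decide +kernel
/-- Sieve stage `3`, chunk `5` (kernel `decide`). [folklore] -/
theorem hst3c5 : ∀ σ ∈ sieveStep 136 64 (chunks3.getD 5 []) (stages.getD 3 (0, [])), σ ∈ lvs.getD 3 [] := by decide +kernel
/-- Sieve stage `3`: the live list `L_3` is mapped into `L_4` (kernel `decide`). [folklore] -/
theorem hst3 : ∀ σ ∈ sieveStep 136 64 ((([[]] : List (List (ℕ × ℤ))) :: lvs).getD 3 []) (stages.getD 3 (0, [])), σ ∈ lvs.getD 3 [] :=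
  sieveStep_subset_of_chunks 136 64 chunks3 (by decide +kernel) fun j hj ↦ by
    have hj' : j < 6 := lt_of_lt_of_eq hj (by decide)
    interval_cases j
    exacts [hst3c0, hst3c1, hst3c2, hst3c3, hst3c4, hst3c5]
/-- Sieve stage `4`: the live list `L_4` is mapped into `L_5` (kernel `decide`). [folklore] -/
theorem hst4 : ∀ σ ∈ sieveStep 136 64 ((([[]] : List (List (ℕ × ℤ))) :: lvs).getD 4 []) (stages.getD 4 (0, [])), σ ∈ lvs.getD 4 [] := by decide +kernel
/-- Sieve stage `5`: the live list `L_5` is mapped into `L_6` (kernel `decide`). [folklore] -/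
theorem hst5 : ∀ σ ∈ sieveStep 136 64 ((([[]] : List (List (ℕ × ℤ))) :: lvs).getD 5 []) (stages.getD 5 (0, [])), σ ∈ lvs.getD 5 [] := by decide +kernel
/-- Sieve stage `6`: the live list `L_6` is mapped into `L_7` (kernel `decide`). [folklore] -/
theorem hst6 : ∀ σ ∈ sieveStep 136 64 ((([[]] : List (List (ℕ × ℤ))) :: lvs).getD 6 []) (stages.getD 6 (0, [])), σ ∈ lvs.getD 6 [] := by decide +kernel
/-- Sieve stage `7`: the live list `L_7` is mapped into `L_8` (kernel `decide`). [folklore] -/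
theorem hst7 : ∀ σ ∈ sieveStep 136 64 ((([[]] : List (List (ℕ × ℤ))) :: lvs).getD 7 []) (stages.getD 7 (0, [])), σ ∈ lvs.getD 7 [] := by decide +kernel
/-- Sieve stage `8`: the live list `L_8` is mapped into `L_9` (kernel `decide`). [folklore] -/
theorem hst8 : ∀ σ ∈ sieveStep 136 64 ((([[]] : List (List (ℕ × ℤ))) :: lvs).getD 8 []) (stages.getD 8 (0, [])), σ ∈ lvs.getD 8 [] := by decide +kernel
/-- Sieve stage `9`: the live list `L_9` is mapped into `L_10` (kernel `decide`). [folklore] -/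
theorem hst9 : ∀ σ ∈ sieveStep 136 64 ((([[]] : List (List (ℕ × ℤ))) :: lvs).getD 9 []) (stages.getD 9 (0, [])), σ ∈ lvs.getD 9 [] := by decide +kernel
/-- Sieve stage `10`: the live list `L_10` is mapped into `L_11` (kernel `decide`). [folklore] -/
theorem hst10 : ∀ σ ∈ sieveStep 136 64 ((([[]] : List (List (ℕ × ℤ))) :: lvs).getD 10 []) (stages.getD 10 (0, [])), σ ∈ lvs.getD 10 [] := by decide +kernel

/-- **THE SIEVE**, certified one stage at a time (`hst0 … hst10`: stage `k` maps the live list `L_k` into `L_{k+1}`),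
assembled by `PinningKernel.runSieve_subset_of_chain` (part D `…PinningKernelStaged`): the staged box sieve returns only assignments listed in `certs`.
[cite: CremonaAlgorithms1997, §2.10] -/
theorem hcover : ∀ σ ∈ runSieve 136 64 stages, σ ∈ certs.map Prod.fst := by
  have hch : ∀ k < stages.length, ∀ σ ∈ sieveStep 136 64 ((([[]] : List (List (ℕ × ℤ))) :: lvs).getD k [])
      (stages.getD k (0, [])), σ ∈ lvs.getD k [] := by
    intro k hk
    have hk' : k < 11 := lt_of_lt_of_eq hk (by decide)
    interval_cases k
    exacts [hst0, hst1, hst2, hst3, hst4, hst5, hst6, hst7, hst8, hst9, hst10]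
  have hlast : ((([[]] : List (List (ℕ × ℤ))) :: lvs).getD stages.length []) = certs.map Prod.fst := by decide +kernel
  exact fun σ hσ ↦ hlast ▸ runSieve_subset_of_chain 136 64 stages lvs (by decide) hch σ hσ

/-- **The coordinate certificates** `d'·aₙ(σ) = Σ_j y_j·tabsⱼ[n]` on the dual support. [folklore] -/
theorem hpiv : ∀ c ∈ certs, ∀ i : Fin 22, ∀ n < (duals i).length, (duals i).getD n 0 ≠ 0 →
    (evalOpt 136 c.1 n).map (fun x ↦ c.2.1 * x) = some (∑ j : Fin 22, c.2.2.getD (j : ℕ) 0 * (tabs j).getD n 0) := by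
  decide +kernel

/-- Every exponent row sums to `4` (weight `2`). [folklore] -/
theorem hsum : ∀ i : Fin 22, ∑ δ ∈ (136 : ℕ).divisors, expFn (Ls[(i : ℕ)]).1 δ = 4 := by
  decide +kernel

/-- The basis is `σ`-closed: `r_i(136/δ) = r_{σ i}(δ)` on the divisors. [cite: Koehler2011, §2.4] -/
theorem hsig : ∀ i : Fin 22, ∀ δ ∈ (136 : ℕ).divisors,
    EtaFricke.frickeExp 136 (expFn (Ls[(i : ℕ)]).1) δ = expFn (Ls[((sig i : Fin 22) : ℕ)]).1 δ := by
  decide +kernel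

/-- The Fricke constants: `knum² · ∏_{r>0} δ^r = 136² · kden² · ∏_{r<0} δ^{−r}`. [cite: Koehler2011, §2.4] -/
theorem hK : ∀ i : Fin 22, 0 < knum i ∧ 0 < kden i ∧
    knum i ^ 2 * posPart 136 (expFn (Ls[(i : ℕ)]).1) = 136 ^ 2 * kden i ^ 2 * negPart 136 (expFn (Ls[(i : ℕ)]).1) := by
  decide +kernel

/-! ## §3 `dim M₂(Γ₀(136)) = 22` -/

/-- `μ(Γ₀(136)) = 216`, `ν_∞ = 8`, `ν₂ = ν₃ = 0`. [cite: DiamondShurman2005, §3.8] -/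
theorem gamma0_data : gamma0Index 136 = 216 ∧ nuInfty 136 = 8 ∧ nu₂ 136 = 0 ∧ nu₃ 136 = 0 := by
  refine ⟨?_, by decide, by rw [nu₂_eq_card]; decide, by rw [nu₃_eq_card]; decide⟩
  · rw [(gamma0Index_mul (m := 8) (n := 17) (by norm_num)), show (8 : ℕ) = 2 ^ 3 by norm_num,
      gamma0Index_prime_pow (p := 2) (e := 3) Nat.prime_two (by norm_num), gamma0Index_prime (by norm_num : Nat.Prime 17)]
    norm_num

/-- **`dim M₂(Γ₀(136)) = 22`** (`g = 15`, `ν_∞ = 8`). [cite: DiamondShurman2005, Thm. 3.5.1] -/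
theorem finrank_modularForm_two : Module.finrank ℂ (ModularForm (Gamma0 136) 2) = 22 := by
  obtain ⟨h1, h2, h3, h4⟩ := gamma0_data
  rw [finrank_modularForm_two_eq 136, genusX0, h1, h2, h3, h4]

/-! ## §4 The pinning (2 classes) -/

/-- **LEVEL 136 PINNED (one of 2 newform classes).**  For every `X₀(136)`-datum of an elliptic `W/ℚ`, with the `η`-quotient
modular forms `Cᵢ` of `Ls`: for some certificate `c = (σ, d', y) ∈ goodCerts` (the 2 classes `136a/136b`; the old classes are
killed by the Fricke rows), the sieve truth of `W` is `σ` and `d' • f = Σ_j y_j • C_j` in `M₂(Γ₀(136))`.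
[cite: CremonaAlgorithms1997, §2.10, Table 1 (136a/136b)] [cite: AtkinLehner1970, Thm. 3] -/
theorem pinning {W : WeierstrassCurve ℚ} [W.IsElliptic] (D : ModularParametrizationData W 136) :
    ∃ C : Fin 22 → ModularForm (Gamma0 136) 2, (∀ i, ∀ τ : ℍ, C i τ = etaQuotient 136 (expFn (Ls[(i : ℕ)]).1) τ) ∧
      ∃ c ∈ goodCerts, truth W (stages.map Prod.fst) = c.1 ∧
        ((c.2.1 : ℤ) : ℂ) • ModularFormClass.modularForm D.f = ∑ j : Fin 22, ((c.2.2.getD (j : ℕ) 0 : ℤ) : ℂ) • C j := by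
  haveI : FiniteDimensional ℂ (ModularForm (Gamma0 136) 2) := Module.finite_of_finrank_eq_succ finrank_modularForm_two
  have hps : ∀ st ∈ stages, st.1.Prime := by
    intro st hst
    have h : st.1 ∈ stages.map Prod.fst := List.mem_map.mpr ⟨st, hst, rfl⟩
    have hl : stages.map Prod.fst = [2, 3, 5, 7, 11, 13, 17, 19, 23, 29, 31] := by decide
    rw [hl] at h
    simp only [List.mem_cons, List.mem_nil_iff, or_false] at h
    rcases h with h | h | h | h | h | h | h | h | h | h | h <;> rw [h] <;> norm_num
  have hinj : Function.Injective sig := by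
    decide
  have hfr : ∀ c ∈ certs, (frickeRowsOK sig knum kden 1 c.2.2 = true ∨ frickeRowsOK sig knum kden (-1) c.2.2 = true) → c ∈ goodCerts := by
    decide
  obtain ⟨C, hC⟩ := exists_etaModularForms 136 Ls hol
  have ht := tables_of_etaCertsSparse 136 64 (fun i : Fin 22 ↦ expFn (Ls[(i : ℕ)]).1) (fun i ↦ shifts i) tabs C hC hshift hcert
  obtain ⟨c, hc, hc1, hpin⟩ := exists_smul_eq_sum_of_certs D (ModularFormClass.modularForm D.f) (modCoefₗ_newform D) C
    tabs duals 8704 ht hlen hdual (by norm_num) finrank_modularForm_two stages hps hrel certs hcover hpiv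
  -- the Fricke sieve
  have hli : LinearIndependent ℂ C := linearIndependent_of_dual C tabs duals 8704 ht hlen hdual (by norm_num)
  have hW := slash_eq_sum_frickePhi C (fun i : Fin 22 ↦ expFn (Ls[(i : ℕ)]).1) hC sig knum kden hsum hsig hK
  have hd' : c.2.1 ≠ 0 := by
    simp only [certs, List.mem_cons, List.mem_nil_iff, or_false] at hc
    rcases hc with rfl | rfl | rfl | rfl <;> decide
  have hrows := frickeRows_of_pinning D C hli sig hinj knum kden (fun i ↦ (hK i).2.1) hW hd' c.2.2 hpin
  exact ⟨C, hC, c, hfr c hc hrows, hc1.symm, hpin⟩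

end Summit.BirchSwinnertonDyer.BirchSwinnertonDyer.Theorems.ManinLocalTwoThree.PinningOneThirtySix

end
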